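import Summits.Schanuel.Schanuel.Theorems.SoloInformedClusterGenericStructuredRoots
import Summits.Schanuel.Schanuel.Theorems.SoloInformedMixedBudget
import Summits.Schanuel.Schanuel.Theorems.SoloInformedMixedRootData

/-!
# Generic MIXED structured roots (multiplicity-weighted selection, budget on the radical)

Solo-informed Schanuel seat, session s191 (2026-08-31); seventh file (K5b) of the seat's
kernel plan for the MIXED Lemma AE₃ (`work/s188/MIXED-AE3-note.md` §2, "GENERIC MIXED
STRUCTURED-ROOTS THEOREM").  It is `soloGC_structured_roots`
(`SoloInformedClusterGenericStructuredRoots`) with two changes: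

* the selection runs over the DISTINCT roots of `Q` with weights `m · log(1/‖ρ − cξ‖)`
  (`m` = multiplicity; `SoloInformedMixedRootData` for the cluster weight `≥ V − c₁ n` and the
  multiplicity-crowding Markov step), and
* the budget is the mixed one (`soloMB_mixed_budget`, `SoloInformedMixedBudget`): for any
  integer polynomial `F ≠ 0` vanishing at all complex roots of `Q` with `deg F ≤ D_F`,
  `log M(F) ≤ L_F`, the hypothesis

    `h₅ : 5400000 (log₂ n + 1) (D_F² L₀ + 2 n D_F L_F + n D_F² log 4) ≤ K² V`

  replaces `900000 (3 n² L₀ + 2 n³) ≤ K² V`.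

Output unchanged: `S' ⊆ [1, K]`, `#S' ≥ 0.49 K`, `γ`, `μ ≠ 0` with `Q(γ + sμ) = 0` and
`‖γ + sμ − sξ‖ ≤ exp(−V K/(1600000 n))` for `s ∈ S'`.  With `F` the radical of `Q`
(`D_F ≈ n/t`, `L_F ≈ L₀/t` in the seat's dilation chain) the budget is quadratic in `n/t`
instead of cubic in `n`: this is the input of THEOREM AE₃♯-2τ (next files).

## Why (seat bookkeeping)

Toy layer only (node `RoyAdditiveDirichletExponent`, [cite: Roy2010, Thm 1.1]); nothing here
bears on `Literature.Periods.SchanuelConjecture`; the seat's verdict (no path) is unchanged.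
No novelty claimed; Mathlib + the seat files only; no definitions; no literature hypotheses;
standard axioms.
-/

namespace Summit.Schanuel.Schanuel.Theorems

open Polynomial Finset

/-- **Generic mixed structured roots.**  See the file header; `W = V K / (1600000 n)`. -/
theorem soloMS_structured_roots {ξ : ℂ} (hξ : Transcendental ℚ ξ) {n K : ℕ} (hn : 1 ≤ n)
    (hK : 2000 ≤ K) {Q : ℤ[X]} (hQ0 : Q ≠ 0) (hQdeg : Q.natDegree ≤ n) {L₀ : ℝ}
    (hL : Real.log (Q.map (Int.castRingHom ℂ)).mahlerMeasure ≤ L₀) {F : ℤ[X]} (hF0 : F ≠ 0)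
    (hFQ : ∀ z : ℂ, aeval z Q = 0 → aeval z F = 0) {D_F L_F : ℝ}
    (hFdeg : (F.natDegree : ℝ) ≤ D_F)
    (hLF : Real.log (F.map (Int.castRingHom ℂ)).mahlerMeasure ≤ L_F) (E : Finset ℕ)
    (hE : 80000 * #E ≤ K) {c₁ V : ℝ} (hc : Real.exp (-c₁) ≤ min 1 (‖ξ‖ / 2))
    (h₁ : 2 * c₁ * n ≤ V)
    (hsmall : ∀ c ∈ Icc 1 K \ E, ‖aeval ((c : ℂ) * ξ) Q‖ ≤ Real.exp (-V))
    (h₄ : Real.log 4 ≤ V * K / (3200000 * n))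
    (h₅ : 5400000 * ((Nat.log 2 n : ℝ) + 1) *
      (D_F ^ 2 * L₀ + 2 * n * D_F * L_F + n * D_F ^ 2 * Real.log 4) ≤ (K : ℝ) ^ 2 * V) :
    ∃ S' : Finset ℕ, S' ⊆ Icc 1 K ∧ (49 : ℝ) / 100 * K ≤ #S' ∧ ∃ γ μ : ℂ, μ ≠ 0 ∧
      ∀ s ∈ S', aeval (γ + (s : ℂ) * μ) Q = 0 ∧
        ‖(γ + (s : ℂ) * μ) - (s : ℂ) * ξ‖ ≤ Real.exp (-(V * K / (1600000 * n))) := by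
  classical
  have hQ' : Q.map (Int.castRingHom ℂ) ≠ 0 :=
    (Polynomial.map_ne_zero_iff Int.cast_injective).mpr hQ0
  obtain ⟨D, ρ, m, hρinj, hm, hm1, hcover, hsum, hprod⟩ :=
    soloMR_exists_distinct_roots (Q.map (Int.castRingHom ℂ)) hQ'
  have hn0 : (0 : ℝ) < n := by exact_mod_cast hn
  have hK0 : (0 : ℝ) < K := by exact_mod_cast (show 0 < K by omega)
  have hlog4pos : 0 < Real.log 4 := Real.log_pos (by norm_num)
  have hV0 : 0 < V := by
    by_contra h
    have h' : V * K / (3200000 * n) ≤ 0 :=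
      div_nonpos_of_nonpos_of_nonneg (mul_nonpos_of_nonpos_of_nonneg (not_lt.mp h) hK0.le)
        (by positivity)
    linarith
  -- Step 0: constants
  set W : ℝ := V * K / (1600000 * n) with hW
  have hW0 : 0 < W := by positivity
  have hW4 : 2 * Real.log 4 ≤ W := by
    rw [show V * K / (3200000 * n) = W / 2 by rw [hW]; ring] at h₄; linarith
  set r : ℝ := min 1 (‖ξ‖ / 2) with hr
  have hr1 : r ≤ 1 := min_le_left _ _
  have hrξ : r ≤ ‖ξ‖ / 2 := min_le_right _ _
  have hc₁0 : 0 ≤ c₁ := by linarith [Real.exp_le_one_iff.mp (hc.trans hr1)]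
  set U : ℝ := V - c₁ * n with hU
  have hU2 : V / 2 ≤ U := by rw [hU]; linarith
  have hU0 : 0 < U := by linarith
  set t₀ : ℝ := 80000 * n / K with ht₀
  have ht₀0 : 0 < t₀ := by positivity
  set θ : ℝ := U / (10 * t₀) with hθ
  have hθW : W ≤ θ := by
    rw [hθ, le_div_iff₀ (by positivity)]
    have h : W * (10 * t₀) = V / 2 := by rw [hW, ht₀]; field_simp; ring
    exact h ▸ hU2
  have hθ4 : 2 * Real.log 4 ≤ θ := hW4.trans hθW
  have hθ0 : 0 ≤ θ := le_trans (by positivity) hθ4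
  have hU'0 : 0 < 9 / 10 * U := by linarith
  -- Step 1: multiplicities; a good point exists, so `Q` has a root; no root at the points
  have hdegmap : (Q.map (Int.castRingHom ℂ)).natDegree = Q.natDegree :=
    natDegree_map_eq_of_injective Int.cast_injective Q
  have hsumn : ∑ k, m k ≤ n := hsum ▸ ((card_roots' _).trans hdegmap.le).trans hQdeg
  have hmN : ∀ k, m k ≤ Q.natDegree := by
    intro k
    have h1 : m k ≤ ∑ k, m k := Finset.single_le_sum (fun _ _ => Nat.zero_le _) (mem_univ k)
    rw [hsum] at h1
    exact h1.trans ((card_roots' _).trans hdegmap.le)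
  have hρroot : ∀ k, aeval (ρ k) Q = 0 := by
    intro k
    have h := ((rootMultiplicity_pos hQ').mp (lt_of_lt_of_le Nat.one_pos ((hm k) ▸ hm1 k)))
    rwa [IsRoot.def, eval_map, ← algebraMap_int_eq, ← aeval_def] at h
  have hρF : ∀ k, aeval (ρ k) F = 0 := fun k => hFQ _ (hρroot k)
  have hgood : (Icc 1 K \ E).Nonempty := by
    rw [Finset.nonempty_iff_ne_empty]
    intro h
    have h1 := Finset.card_le_card (Finset.sdiff_eq_empty_iff_subset.mp h)
    rw [Nat.card_Icc] at h1; omega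
  have hsmall' : ∀ x ∈ Icc 1 K \ E,
      ‖(Q.map (Int.castRingHom ℂ)).eval ((x : ℂ) * ξ)‖ ≤ Real.exp (-V) := by
    intro x hx
    rw [eval_map_intCastRingHom]
    exact hsmall x hx
  have hD0 : 0 < D := by
    have hdeg0 : 0 < Q.natDegree := by
      by_contra h
      have h0 : Q.natDegree = 0 := by omega
      obtain ⟨x, hx⟩ := hgood
      have h1 := hsmall x hx
      rw [eq_C_of_natDegree_eq_zero h0, aeval_C, eq_intCast, Complex.norm_intCast] at h1
      have hc0 : Q.coeff 0 ≠ 0 := fun hc0 => hQ0 (by rw [eq_C_of_natDegree_eq_zero h0, hc0, C_0])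
      have h2 : (1 : ℝ) ≤ |(Q.coeff 0 : ℝ)| := by exact_mod_cast Int.one_le_abs hc0
      have h3 : Real.exp (-V) < 1 := Real.exp_lt_one_iff.mpr (by linarith)
      linarith
    have hdeg' : 0 < (Q.map (Int.castRingHom ℂ)).degree := by
      rwa [← natDegree_pos_iff_degree_pos, hdegmap]
    obtain ⟨z, hz⟩ := Complex.exists_root hdeg'
    obtain ⟨k, -⟩ := hcover z hz
    exact k.pos
  have hlc : 1 ≤ ‖(Q.map (Int.castRingHom ℂ)).leadingCoeff‖ := by
    rw [leadingCoeff_map_of_injective Int.cast_injective, eq_intCast, Complex.norm_intCast]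
    exact_mod_cast Int.one_le_abs (leadingCoeff_ne_zero.mpr hQ0)
  have hρne : ∀ x ∈ Icc 1 K \ E, ∀ k, ρ k ≠ (x : ℂ) * ξ := by
    intro x hx k h
    have hx1 : 1 ≤ x := (Finset.mem_Icc.mp (Finset.mem_sdiff.mp hx).1).1
    have hx0 : (x : ℤ) ≠ 0 := by omega
    have hne := soloDF_aeval_comp_C_mul_X_ne_zero hξ hQ0 hx0
    rw [soloDF_aeval_comp_C_mul_X, Int.cast_natCast, ← h] at hne
    exact hne (hρroot k)
  -- Step 2: clusters and the uncrowded good set `S` (multiplicity crowding)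
  set Cl : ℕ → Finset (Fin D) := fun x => univ.filter (fun k => ‖ρ k - x * ξ‖ < r) with hCl
  have hClmem : ∀ x k, k ∈ Cl x ↔ ‖ρ k - x * ξ‖ < r := by intro x k; simp [hCl]
  set S : Finset ℕ := (Icc 1 K \ E).filter (fun x => ((∑ k ∈ Cl x, m k : ℕ) : ℝ) ≤ t₀)
    with hS
  have hSsub : S ⊆ Icc 1 K \ E := Finset.filter_subset _ _
  have hSI : S ⊆ Icc 1 K := fun s hs => (Finset.mem_sdiff.mp (hSsub hs)).1
  have hE' : 40000 * #(Icc 1 K \ S) ≤ K := by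
    have hsub : (Icc 1 K \ E) \ S ⊆ (Icc 1 K \ E).filter (fun c : ℕ => t₀ <
        ((∑ k ∈ univ.filter (fun k => ‖ρ k - (c * ξ + 0)‖ < ‖ξ‖ / 2), m k : ℕ) : ℝ)) := by
      intro x hx
      obtain ⟨hxI, hxS⟩ := Finset.mem_sdiff.mp hx
      refine Finset.mem_filter.mpr ⟨hxI, ?_⟩
      have hlt : t₀ < ((∑ k ∈ Cl x, m k : ℕ) : ℝ) :=
        not_le.mp fun h => hxS (Finset.mem_filter.mpr ⟨hxI, h⟩)
      refine hlt.trans_le ?_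
      have hle : ∑ k ∈ Cl x, m k ≤
          ∑ k ∈ univ.filter (fun k => ‖ρ k - (x * ξ + 0)‖ < ‖ξ‖ / 2), m k := by
        refine Finset.sum_le_sum_of_subset_of_nonneg (fun k hk => ?_)
          (fun _ _ _ => Nat.zero_le _)
        rw [hClmem] at hk
        simp only [Finset.mem_filter, Finset.mem_univ, true_and, add_zero]
        exact hk.trans_le hrξ
      exact_mod_cast hle
    have h1 := soloMR_card_crowded_mul_le ρ m ξ 0 (Icc 1 K \ E) t₀
    have h2 : (#((Icc 1 K \ E) \ S) : ℝ) * t₀ ≤ n := by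
      calc (#((Icc 1 K \ E) \ S) : ℝ) * t₀
          ≤ (#((Icc 1 K \ E).filter (fun c : ℕ => t₀ <
              ((∑ k ∈ univ.filter (fun k => ‖ρ k - (c * ξ + 0)‖ < ‖ξ‖ / 2), m k : ℕ) :
                ℝ))) : ℝ) * t₀ :=
            mul_le_mul_of_nonneg_right (by exact_mod_cast Finset.card_le_card hsub) ht₀0.le
        _ ≤ ((∑ k, m k : ℕ) : ℝ) := h1
        _ ≤ n := by exact_mod_cast hsumn
    rw [ht₀, ← mul_div_assoc, div_le_iff₀ hK0] at h2
    have h3 : (80000 * (#((Icc 1 K \ E) \ S) : ℝ)) * n ≤ K * n := by linarith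
    have h4 := le_of_mul_le_mul_right h3 hn0
    have h5 : 80000 * #((Icc 1 K \ E) \ S) ≤ K := by exact_mod_cast h4
    have h6 : Icc 1 K \ S ⊆ E ∪ ((Icc 1 K \ E) \ S) := by
      intro x hx
      rw [Finset.mem_union, Finset.mem_sdiff, Finset.mem_sdiff]
      rw [Finset.mem_sdiff] at hx
      by_cases hxE : x ∈ E
      · exact Or.inl hxE
      · exact Or.inr ⟨⟨hx.1, hxE⟩, hx.2⟩
    have h7 := (Finset.card_le_card h6).trans (Finset.card_union_le _ _); omega
  -- Step 3: weights `u`, selection weights `w = m u`, heavy sub-clusters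
  set u : ℕ → Fin D → ℝ := fun x k => Real.log (1 / ‖ρ k - x * ξ‖) with hu
  set w : ℕ → Fin D → ℝ := fun x k => (m k : ℝ) * u x k with hw
  have hUx : ∀ x ∈ Icc 1 K \ E, U ≤ ∑ k ∈ Cl x, w x k := by
    intro x hx
    exact soloMR_cluster_weight_ge (N := n) _ hlc ρ m hprod hsumn ((x : ℂ) * ξ) hr1 hc
      (hsmall' x hx) (hρne x hx)
  have hupos : ∀ x ∈ Icc 1 K \ E, ∀ k ∈ Cl x, 0 < u x k :=
    fun x hx k hk => soloCW_log_inv_pos hr1 ((hClmem x k).mp hk) (hρne x hx k)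
  have hm0 : ∀ k, (0 : ℝ) < m k := fun k => by exact_mod_cast hm1 k
  have hwpos : ∀ x ∈ Icc 1 K \ E, ∀ k ∈ Cl x, 0 < w x k :=
    fun x hx k hk => mul_pos (hm0 k) (hupos x hx k hk)
  have hdist : ∀ x ∈ Icc 1 K \ E, ∀ k, ‖ρ k - x * ξ‖ ≤ Real.exp (-u x k) :=
    fun x hx k => le_of_eq (soloCW_exp_neg_log_inv (hρne x hx k)).symm
  set Cl' : ℕ → Finset (Fin D) := fun x => (Cl x).filter (fun k => θ ≤ u x k) with hCl'
  have hCl'sub : ∀ x, Cl' x ⊆ Cl x := fun x => Finset.filter_subset _ _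
  have hCl'θ : ∀ x, ∀ k ∈ Cl' x, θ ≤ u x k := fun x k hk => (Finset.mem_filter.mp hk).2
  have hU' : ∀ x ∈ S, 9 / 10 * U ≤ ∑ k ∈ Cl' x, w x k := by
    intro x hx
    obtain ⟨hxI, hxt⟩ := Finset.mem_filter.mp hx
    have hsplit := Finset.sum_filter_add_sum_filter_not (Cl x) (fun k => θ ≤ u x k) (w x)
    have hle : ∑ k ∈ (Cl x).filter (fun k => ¬ θ ≤ u x k), w x k ≤ t₀ * θ := by
      calc ∑ k ∈ (Cl x).filter (fun k => ¬ θ ≤ u x k), w x k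
          ≤ ∑ k ∈ (Cl x).filter (fun k => ¬ θ ≤ u x k), (m k : ℝ) * θ :=
            Finset.sum_le_sum (fun k hk => mul_le_mul_of_nonneg_left
              (not_le.mp (Finset.mem_filter.mp hk).2).le (hm0 k).le)
        _ ≤ ∑ k ∈ Cl x, (m k : ℝ) * θ :=
            Finset.sum_le_sum_of_subset_of_nonneg (Finset.filter_subset _ _)
              (fun k _ _ => mul_nonneg (hm0 k).le hθ0)
        _ = ((∑ k ∈ Cl x, m k : ℕ) : ℝ) * θ := by push_cast; rw [Finset.sum_mul]
        _ ≤ t₀ * θ := mul_le_mul_of_nonneg_right hxt hθ0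
    have h3 : t₀ * θ = U / 10 := by rw [hθ]; field_simp
    have h4 := hUx x hxI
    rw [h3] at hle
    show 9 / 10 * U ≤ ∑ k ∈ (Cl x).filter (fun k => θ ≤ u x k), w x k
    linarith
  have hne' : ∀ x ∈ S, (Cl' x).Nonempty := by
    intro x hx
    by_contra h
    have h' := hU' x hx
    rw [Finset.not_nonempty_iff_eq_empty.mp h, Finset.sum_empty] at h'; linarith
  have hw' : ∀ x ∈ S, ∀ k ∈ Cl' x, 0 < w x k :=
    fun x hx k hk => hwpos x (hSsub hx) k (hCl'sub x hk)
  -- Step 4: non-trivial progressions of `S`, bad triples, the weighted selection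
  set A : Finset (ℕ × ℕ × ℕ) := (S ×ˢ (S ×ˢ S)).filter
    (fun c => c.1 + c.2.2 = 2 * c.2.1 ∧ c.1 ≠ c.2.2) with hA
  set Bad : Finset (Fin D × Fin D × Fin D) :=
    univ.filter (fun q => ρ q.1 + ρ q.2.2 - 2 * ρ q.2.1 ≠ 0) with hBad
  have hAS : ∀ c ∈ A, c.1 ∈ S ∧ c.2.1 ∈ S ∧ c.2.2 ∈ S := by
    intro c hc
    rw [hA, Finset.mem_filter, Finset.mem_product, Finset.mem_product] at hc
    exact hc.1
  have hAd : ∀ c ∈ A, c.1 ≠ c.2.1 ∧ c.2.1 ≠ c.2.2 ∧ c.1 ≠ c.2.2 := by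
    intro c hc
    rw [hA, Finset.mem_filter] at hc
    obtain ⟨-, h1, h2⟩ := hc
    omega
  obtain ⟨rsel, hrCl, hcost⟩ := soloSel_exists_selection hD0 S Cl' w hw' hne' A hAS hAd Bad
  -- Step 5: the mixed budget
  have hbudget := soloMB_mixed_budget Q F hQ0 hF0 ρ hρinj hρF m hm hm1 hmN ξ hrξ S Cl'
    (fun x _ k hk => (hClmem x k).mp (hCl'sub x hk)) u
    (fun x hx k _ => hdist x (hSsub hx) k) hθ4 (fun x _ k hk => hCl'θ x k hk) w
    (fun _ _ => rfl) hU'0 hU'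
  set V₃ : Finset (ℕ × ℕ × ℕ) :=
    A.filter (fun c => (rsel c.1, rsel c.2.1, rsel c.2.2) ∈ Bad) with hV₃
  set B : ℝ := D_F ^ 2 * L₀ + 2 * n * D_F * L_F + n * D_F ^ 2 * Real.log 4 with hB
  have hmain : 9 / 10 * U * (#V₃ : ℝ) ≤ 12 * (Nat.log 2 Q.natDegree + 1) *
      ((F.natDegree : ℝ) ^ 2 * Real.log (Q.map (Int.castRingHom ℂ)).mahlerMeasure
        + 2 * Q.natDegree * F.natDegree * Real.log (F.map (Int.castRingHom ℂ)).mahlerMeasure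
        + Q.natDegree * (F.natDegree : ℝ) ^ 2 * Real.log 4) :=
    (mul_le_mul_of_nonneg_left hcost hU'0.le).trans hbudget
  have hlogM0 : 0 ≤ Real.log (Q.map (Int.castRingHom ℂ)).mahlerMeasure :=
    Real.log_nonneg (Polynomial.one_le_mahlerMeasure_of_ne_zero hQ0)
  have hlogF0 : 0 ≤ Real.log (F.map (Int.castRingHom ℂ)).mahlerMeasure :=
    Real.log_nonneg (Polynomial.one_le_mahlerMeasure_of_ne_zero hF0)
  have hDF0 : (0 : ℝ) ≤ F.natDegree := Nat.cast_nonneg _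
  have hNQ : (Q.natDegree : ℝ) ≤ n := by exact_mod_cast hQdeg
  have hB' : (F.natDegree : ℝ) ^ 2 * Real.log (Q.map (Int.castRingHom ℂ)).mahlerMeasure
      + 2 * Q.natDegree * F.natDegree * Real.log (F.map (Int.castRingHom ℂ)).mahlerMeasure
      + Q.natDegree * (F.natDegree : ℝ) ^ 2 * Real.log 4 ≤ B := by
    rw [hB]
    have hDF : (0 : ℝ) ≤ D_F := hDF0.trans hFdeg
    have hDF2 : (F.natDegree : ℝ) ^ 2 ≤ D_F ^ 2 := pow_le_pow_left₀ hDF0 hFdeg 2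
    have e1 := mul_le_mul hDF2 hL hlogM0 (by positivity)
    have e2 : 2 * (Q.natDegree : ℝ) * F.natDegree *
        Real.log (F.map (Int.castRingHom ℂ)).mahlerMeasure ≤ 2 * n * D_F * L_F :=
      mul_le_mul (mul_le_mul (by linarith) hFdeg hDF0 (by positivity)) hLF hlogF0
        (by positivity)
    have e3 : (Q.natDegree : ℝ) * (F.natDegree : ℝ) ^ 2 * Real.log 4 ≤
        n * D_F ^ 2 * Real.log 4 :=
      mul_le_mul_of_nonneg_right (mul_le_mul hNQ hDF2 (by positivity) hn0.le) hlog4pos.le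
    linarith
  have hB0 : 0 ≤ B := by
    have hDF : (0 : ℝ) ≤ D_F := hDF0.trans hFdeg
    have hL₀ : 0 ≤ L₀ := hlogM0.trans hL
    have hLF' : 0 ≤ L_F := hlogF0.trans hLF
    rw [hB]; positivity
  have hJ : (Nat.log 2 Q.natDegree : ℝ) + 1 ≤ (Nat.log 2 n : ℝ) + 1 := by
    have h' : (Nat.log 2 Q.natDegree : ℝ) ≤ Nat.log 2 n := by
      exact_mod_cast Nat.log_mono_right (b := 2) hQdeg
    linarith
  have hmain' : 9 / 10 * U * (#V₃ : ℝ) ≤ 12 * ((Nat.log 2 n : ℝ) + 1) * B := by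
    refine hmain.trans ?_
    have hJ0 : (0 : ℝ) ≤ (Nat.log 2 Q.natDegree : ℝ) + 1 := by positivity
    calc 12 * ((Nat.log 2 Q.natDegree : ℝ) + 1) * _
        ≤ 12 * ((Nat.log 2 Q.natDegree : ℝ) + 1) * B :=
          mul_le_mul_of_nonneg_left hB' (by positivity)
      _ ≤ 12 * ((Nat.log 2 n : ℝ) + 1) * B := by
          exact mul_le_mul_of_nonneg_right (mul_le_mul_of_nonneg_left hJ (by norm_num)) hB0
  have hVK : 200000 * #V₃ ≤ K ^ 2 := by
    have key : (200000 * #V₃ : ℝ) * (9 / 10 * U) ≤ (K : ℝ) ^ 2 * (9 / 10 * U) := by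
      calc (200000 * #V₃ : ℝ) * (9 / 10 * U) = 200000 * (9 / 10 * U * (#V₃ : ℝ)) := by ring
        _ ≤ 200000 * (12 * ((Nat.log 2 n : ℝ) + 1) * B) :=
            mul_le_mul_of_nonneg_left hmain' (by norm_num)
        _ ≤ (K : ℝ) ^ 2 * (9 / 10 * (V / 2)) := by
            have hKV : (0 : ℝ) ≤ (K : ℝ) ^ 2 * V := by positivity
            linarith [h₅, hKV]
        _ ≤ (K : ℝ) ^ 2 * (9 / 10 * U) :=
            mul_le_mul_of_nonneg_left (mul_le_mul_of_nonneg_left hU2 (by norm_num))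
              (by positivity)
    exact_mod_cast le_of_mul_le_mul_right key hU'0
  -- Step 6: Theorem C₃ (even part)
  have hVmem : ∀ x ∈ S, ∀ m' ∈ S, ∀ z ∈ S, x + z = 2 * m' →
      (fun s => ρ (rsel s)) x + (fun s => ρ (rsel s)) z ≠ 2 • (fun s => ρ (rsel s)) m' →
        (x, m', z) ∈ V₃ := by
    intro x hx m' hm' z hz hxz hne
    have hxz' : x ≠ z := by
      rintro rfl
      apply hne
      have hmx : m' = x := by omega
      subst hmx
      simp only [two_nsmul]
    rw [hV₃, Finset.mem_filter]
    refine ⟨?_, ?_⟩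
    · rw [hA, Finset.mem_filter, Finset.mem_product, Finset.mem_product]
      exact ⟨⟨hx, hm', hz⟩, hxz, hxz'⟩
    · rw [hBad, Finset.mem_filter]
      refine ⟨Finset.mem_univ _, ?_⟩
      intro h
      apply hne
      simp only [nsmul_eq_mul, Nat.cast_ofNat]
      exact sub_eq_zero.mp h
  obtain ⟨γ, μ, Y, hYcard, hY⟩ :=
    soloAR_even_affine_of_few_violated_progressions hK hE' (fun s => ρ (rsel s)) hVmem hVK
  have hY' : ∀ y ∈ Y, 2 * y ∈ S ∧ ρ (rsel (2 * y)) = γ + ((2 * y : ℕ) : ℂ) * (μ / 2) := by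
    intro y hy
    obtain ⟨hyS, h⟩ := hY y hy
    refine ⟨hyS, ?_⟩
    have h' : ρ (rsel (2 * y)) = γ + (y : ℂ) * μ := by simpa only [nsmul_eq_mul] using h
    rw [h']; push_cast; ring
  -- Step 7: distances of the selected roots
  have hnear : ∀ s ∈ S, ‖ρ (rsel s) - (s : ℂ) * ξ‖ < ‖ξ‖ / 2 :=
    fun s hs => ((hClmem s _).mp (hCl'sub s (hrCl s hs))).trans_le hrξ
  have hservedε : ∀ s ∈ S, ‖ρ (rsel s) - (s : ℂ) * ξ‖ ≤ Real.exp (-W) := by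
    intro s hs
    refine (hdist s (hSsub hs) (rsel s)).trans (Real.exp_le_exp.mpr (neg_le_neg ?_))
    exact hθW.trans (hCl'θ s _ (hrCl s hs))
  -- Step 8: the structured set `S' = 2 • Y`
  set S' := Y.image (fun y => 2 * y) with hS'
  have hS'sub : S' ⊆ Icc 1 K := by
    intro s hs
    obtain ⟨y, hy, rfl⟩ := Finset.mem_image.mp hs
    exact hSI (hY' y hy).1
  have hS'card' : #S' = #Y :=
    Finset.card_image_of_injective _ (fun a b h => by simpa using h)
  have hS'card : (49 : ℝ) / 100 * K ≤ #S' := by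
    rw [hS'card']
    have h : ((49 * K : ℕ) : ℝ) ≤ ((100 * #Y : ℕ) : ℝ) := by exact_mod_cast hYcard
    push_cast at h
    linarith
  have hS'aff : ∀ s ∈ S', s ∈ S ∧ ρ (rsel s) = γ + (s : ℂ) * (μ / 2) := by
    intro s hs
    obtain ⟨y, hy, rfl⟩ := Finset.mem_image.mp hs
    exact hY' y hy
  have hμ : μ / 2 ≠ 0 := by
    intro hμ
    have hK' : (2000 : ℝ) ≤ K := by exact_mod_cast hK
    have h980 : (980 : ℝ) ≤ #S' := by linarith
    have hcard' : 1 < #S' := by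
      have : (980 : ℕ) ≤ #S' := by exact_mod_cast h980
      omega
    obtain ⟨a, ha, b, hb, hab⟩ := Finset.one_lt_card.mp hcard'
    obtain ⟨haS, hφa⟩ := hS'aff a ha
    obtain ⟨hbS, hφb⟩ := hS'aff b hb
    rw [hμ, mul_zero, add_zero] at hφa hφb
    have h1 := hφa ▸ hnear a haS
    have h2 := hφb ▸ hnear b hbS
    have h3 : ‖(a : ℂ) * ξ - (b : ℂ) * ξ‖ < ‖ξ‖ := by
      calc ‖(a : ℂ) * ξ - (b : ℂ) * ξ‖ = ‖(γ - (b : ℂ) * ξ) - (γ - (a : ℂ) * ξ)‖ := by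
            congr 1; ring
        _ ≤ ‖γ - (b : ℂ) * ξ‖ + ‖γ - (a : ℂ) * ξ‖ := norm_sub_le _ _
        _ < ‖ξ‖ / 2 + ‖ξ‖ / 2 := add_lt_add h2 h1
        _ = ‖ξ‖ := by ring
    have h4 : ‖ξ‖ ≤ ‖(a : ℂ) * ξ - (b : ℂ) * ξ‖ := by
      rw [← sub_mul, norm_mul]
      have hab' : (1 : ℝ) ≤ ‖((a : ℂ) - (b : ℂ))‖ := by
        have : ((a : ℂ) - (b : ℂ)) = ((a - b : ℤ) : ℂ) := by push_cast; ring
        rw [this, Complex.norm_intCast]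
        have hne : (a : ℤ) - b ≠ 0 := by omega
        exact_mod_cast Int.one_le_abs hne
      exact le_mul_of_one_le_left (norm_nonneg _) hab'
    linarith
  refine ⟨S', hS'sub, hS'card, γ, μ / 2, hμ, ?_⟩
  intro s hs
  obtain ⟨hsS, hφs⟩ := hS'aff s hs
  rw [← hφs]
  exact ⟨hρroot (rsel s), hservedε s hsS⟩

end Summit.Schanuel.Schanuel.Theorems
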